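import Summits.Ventures.PercRepro.C025ProfileRankFourLemmas

/-!
# The rank-4 certificate: (Cap)(d) — a rank-3 set with at least five points pays at most 3 (night-3 g8)

NIGHT3-G7-RANK4-CERTIFICATE.md §3(d), in the kernel: for a rank-`3` set `S` with `|S| ≥ 5` in a simple matroid of rank
`4`, only a rank-`2` set `B = S ∖ {y}` (one extra point, `|B| ≥ 4`) can be paid — a pair has `≥ 3` extra points, a larger
set with two extra points is not a pair — and at most one such `B` exists (`eq_of_erase_eRk_two`). Its weight
`p/(r + 1 − j)` (`p = ρ(E∖B) ≤ min(4, r + 1)`, `r = ρ(E∖S)`, `j = j(B)`) is at most `2`: for `j = 0` it is `≤ 1`; for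
`j = 1` the extra point `z` of the line `cl B` lies in `E ∖ S`, so `r ≥ 2` (else `E ∖ S = {z}` and `E ⊆ cl B ∪ {y}` has rank
`≤ 3`) and the weight is `p/r ≤ 3/2`; for `j = 2` two points of `cl B` lie in `E ∖ S`, so `cl B ⊆ cl(E∖S)` and `r ≥ 3`
(else `E ⊆ cl(E∖S) ∪ {y}` has rank `≤ 3`), and the weight is `p/(r − 1) ≤ 2`.
-/

open scoped Matroid

namespace PercRepro

open Set Finset ThmH

section CapD

variable {α : Type} [DecidableEq α] {M : Matroid α} [M.Finite]

omit [DecidableEq α] in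
/-- The rank of the ground set is the rank of `M`. -/
theorem eRk_gr_eq_eRank : M.eRk ((gr M : Finset α) : Set α) = M.eRank := by
  rw [coe_gr, M.eRank_def]

/-- **(Cap)(d), the weight bound**: in a simple matroid of rank `4`, a rank-`2` set `B = S ∖ {y}` of a rank-`3` set `S`
with `|B| ≥ 3` is paid at most `2`. -/
theorem w4n_le_two_of_sdiff_singleton (hR : M.eRank = (4 : ℕ∞)) (hsimple : ∀ T ⊆ M.E, T.encard ≤ 2 → M.Indep T)
    {S B : Finset α} (hS : S ∈ Shadow.levelSet M 3) (hB : B ∈ Profile.Rq M 2) (hBS : B ⊆ S) (hB3 : 3 ≤ B.card)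
    {y : α} (hy : S \ B = {y}) : w4n M B S ≤ 2 := by
  classical
  rw [Profile.mem_levelSet] at hS
  obtain ⟨hSg, hS3⟩ := hS
  rw [Profile.mem_Rq] at hB
  obtain ⟨hBg, hB2⟩ := hB
  have hyS : y ∈ S := by
    have : y ∈ S \ B := by rw [hy]; exact Finset.mem_singleton_self y
    exact (Finset.mem_sdiff.1 this).1
  have hyB : y ∉ B := by
    have : y ∈ S \ B := by rw [hy]; exact Finset.mem_singleton_self y
    exact (Finset.mem_sdiff.1 this).2
  have hSeq : S = insert y B := by
    ext x
    rw [Finset.mem_insert]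
    constructor
    · intro hx
      by_cases hxB : x ∈ B
      · exact Or.inr hxB
      · left
        have : x ∈ S \ B := Finset.mem_sdiff.2 ⟨hx, hxB⟩
        rw [hy] at this
        exact Finset.mem_singleton.1 this
    · rintro (rfl | hx)
      · exact hyS
      · exact hBS hx
  by_cases hp3 : crk M B < 3
  · rw [w4n_eq_zero_of_crk_lt_three hp3]; norm_num
  push Not at hp3
  have hp4 : crk M B ≤ 4 := crk_le_of_eRank hR B
  have hpr : crk M B ≤ crk M S + 1 := crk_le_crk_add_one_of_sdiff_singleton hy
  have hsd : (S \ B).card = 1 := by rw [hy, Finset.card_singleton]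
  unfold w4n
  rw [w4_of_sdiff_card_one_of_three_le_card hsd hB3 hp3]
  have hpq : (crk M B : ℚ) ≤ 4 := by exact_mod_cast hp4
  have hprq : (crk M B : ℚ) ≤ (crk M S : ℚ) + 1 := by exact_mod_cast hpr
  have hj2 : jB M B ≤ 2 := by unfold jB; exact min_le_left _ _
  -- y is not on the line of B
  have hyL : y ∉ clF M B := by
    intro h
    rw [← Finset.mem_coe, coe_clF] at h
    have : M.eRk (S : Set α) ≤ 2 := by
      calc M.eRk (S : Set α) ≤ M.eRk (M.closure (B : Set α)) := by
            apply M.eRk_mono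
            rw [hSeq, Finset.coe_insert]
            exact Set.insert_subset h (M.subset_closure _ (by rw [← coe_gr]; exact_mod_cast hBg))
        _ = 2 := by rw [M.eRk_closure_eq, hB2]; rfl
    rw [hS3] at this
    exact absurd this (by decide)
  have hLS : clF M B \ B ⊆ gr M \ S := by
    intro z hz
    rw [Finset.mem_sdiff] at hz ⊢
    refine ⟨clF_subset_gr B hz.1, ?_⟩
    rw [hSeq, Finset.mem_insert, not_or]
    refine ⟨?_, hz.2⟩
    rintro rfl; exact hyL hz.1
  have hcard : (clF M B \ B).card = (clF M B).card - B.card := Finset.card_sdiff_of_subset (subset_clF_self hBg)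
  have hrank4 : M.eRk ((gr M : Finset α) : Set α) = 4 := by rw [eRk_gr_eq_eRank, hR]
  rcases Nat.lt_or_ge (jB M B) 1 with hj0 | hj1
  · -- j = 0: the weight is p/(r + 1) ≤ 1
    have hj : jB M B = 0 := by omega
    rw [hj]
    apply max_le (by norm_num)
    have hrpos : (0 : ℚ) < (crk M S : ℚ) + 1 - ((0 : ℕ) : ℚ) := by
      have : (0 : ℚ) ≤ (crk M S : ℚ) := Nat.cast_nonneg _
      push_cast; linarith
    rw [div_le_iff₀ hrpos]
    push_cast
    linarith
  · -- j ≥ 1: a point z of the line outside B, hence in E ∖ S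
    have hT1 : 1 ≤ (clF M B \ B).card := by unfold jB at hj1; omega
    obtain ⟨z, hz⟩ := Finset.card_pos.1 hT1
    have hzES : z ∈ gr M \ S := hLS hz
    rcases Nat.lt_or_ge (jB M B) 2 with hj1' | hj2'
    · -- j = 1: r ≥ 2
      have hj : jB M B = 1 := by omega
      have hr2 : 2 ≤ crk M S := by
        by_contra hr
        push Not at hr
        have hr1 : M.eRk ((gr M \ S : Finset α) : Set α) ≤ 1 := by
          rw [eRk_gr_sdiff_eq_crk]; exact_mod_cast Nat.lt_succ_iff.1 hr
        have hc1 := card_le_one_of_eRk_le_one hsimple Finset.sdiff_subset hr1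
        -- E ∖ S = {z}, so E ⊆ cl B ∪ {y}
        have hsub : gr M ⊆ insert y (clF M B) := by
          intro x hx
          rw [Finset.mem_insert]
          by_cases hxS : x ∈ S
          · rw [hSeq, Finset.mem_insert] at hxS
            rcases hxS with rfl | hxB
            · exact Or.inl rfl
            · exact Or.inr (subset_clF_self hBg hxB)
          · right
            have hxES : x ∈ gr M \ S := Finset.mem_sdiff.2 ⟨hx, hxS⟩
            have : x = z := Finset.card_le_one.1 hc1 x hxES z hzES
            rw [this]; exact (Finset.mem_sdiff.1 hz).1
        have : M.eRk ((gr M : Finset α) : Set α) ≤ 3 := by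
          calc M.eRk ((gr M : Finset α) : Set α) ≤ M.eRk ((insert y (clF M B) : Finset α) : Set α) :=
                M.eRk_mono (Finset.coe_subset.2 hsub)
            _ ≤ M.eRk ((clF M B : Finset α) : Set α) + 1 := by
                rw [Finset.coe_insert]; exact M.eRk_insert_le_add_one _ _
            _ = 3 := by rw [eRk_clF_of_eRk_two hB2]; rfl
        rw [hrank4] at this
        exact absurd this (by decide)
      rw [hj]
      apply max_le (by norm_num)
      have hr2q : (2 : ℚ) ≤ (crk M S : ℚ) := by exact_mod_cast hr2
      have hrpos : (0 : ℚ) < (crk M S : ℚ) + 1 - ((1 : ℕ) : ℚ) := by push_cast; linarith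
      rw [div_le_iff₀ hrpos]
      push_cast
      linarith
    · -- j = 2: r ≥ 3
      have hj : jB M B = 2 := by omega
      have hT2 : 2 ≤ (clF M B \ B).card := by unfold jB at hj2'; omega
      obtain ⟨z', hz', hzz'⟩ : ∃ z' ∈ clF M B \ B, z' ≠ z := by
        by_contra hcon
        push Not at hcon
        have : clF M B \ B ⊆ {z} := fun w hw => Finset.mem_singleton.2 (hcon w hw)
        have := Finset.card_le_card this
        rw [Finset.card_singleton] at this
        omega
      have hz'ES : z' ∈ gr M \ S := hLS hz'
      have hr3 : 3 ≤ crk M S := by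
        by_contra hr
        push Not at hr
        have hr2 : M.eRk ((gr M \ S : Finset α) : Set α) ≤ 2 := by
          rw [eRk_gr_sdiff_eq_crk]; exact_mod_cast Nat.lt_succ_iff.1 hr
        -- the line of B lies in cl(E ∖ S)
        have hline : ((clF M B : Finset α) : Set α) ⊆ M.closure ((gr M \ S : Finset α) : Set α) :=
          clF_subset_closure_of_two_mem hsimple hB2 hzz' (Finset.mem_sdiff.1 hz').1 (Finset.mem_sdiff.1 hz).1
            (by exact_mod_cast hz'ES) (by exact_mod_cast hzES)
        have hsub : ((gr M : Finset α) : Set α) ⊆ insert y (M.closure ((gr M \ S : Finset α) : Set α)) := by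
          intro x hx
          rw [Set.mem_insert_iff]
          rw [Finset.mem_coe] at hx
          by_cases hxS : x ∈ S
          · rw [hSeq, Finset.mem_insert] at hxS
            rcases hxS with rfl | hxB
            · exact Or.inl rfl
            · exact Or.inr (hline (subset_clF_self hBg hxB))
          · right
            exact M.subset_closure _ (by rw [Finset.coe_sdiff, coe_gr]; exact Set.sdiff_subset)
              (by rw [Finset.mem_coe]; exact Finset.mem_sdiff.2 ⟨hx, hxS⟩)
        have : M.eRk ((gr M : Finset α) : Set α) ≤ 3 := by
          calc M.eRk ((gr M : Finset α) : Set α)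
              ≤ M.eRk (insert y (M.closure ((gr M \ S : Finset α) : Set α))) := M.eRk_mono hsub
            _ ≤ M.eRk (M.closure ((gr M \ S : Finset α) : Set α)) + 1 := M.eRk_insert_le_add_one _ _
            _ ≤ 2 + 1 := by rw [M.eRk_closure_eq]; exact add_le_add_left hr2 _
            _ = 3 := by norm_num
        rw [hrank4] at this
        exact absurd this (by decide)
      rw [hj]
      apply max_le (by norm_num)
      have hr3q : (3 : ℚ) ≤ (crk M S : ℚ) := by exact_mod_cast hr3
      have hrpos : (0 : ℚ) < (crk M S : ℚ) + 1 - ((2 : ℕ) : ℚ) := by push_cast; linarith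
      rw [div_le_iff₀ hrpos]
      push_cast
      linarith

/-- **(Cap)(d)**: in a simple matroid of rank `4`, a rank-`3` set with at least five points pays at most `3`
(in fact at most `2`). -/
theorem cap_w4n_of_five_le_card (hR : M.eRank = (4 : ℕ∞)) (hsimple : ∀ T ⊆ M.E, T.encard ≤ 2 → M.Indep T)
    {S : Finset α} (hS : S ∈ Shadow.levelSet M 3) (hS5 : 5 ≤ S.card) :
    ∑ B ∈ (Profile.Rq M 2).filter (fun B => B ⊆ S), w4n M B S ≤ 3 := by
  classical
  set Φ := (Profile.Rq M 2).filter (fun B => B ⊆ S) with hΦ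
  have hSg : S ⊆ gr M := (Profile.mem_levelSet.1 hS).1
  have hS3 : M.eRk (S : Set α) = 3 := (Profile.mem_levelSet.1 hS).2
  -- sets with a different number of extra points are paid nothing
  have hzero : ∀ B ∈ Φ, ¬ (S \ B).card = 1 → w4n M B S = 0 := by
    intro B hB hne
    have hBS : B ⊆ S := (Finset.mem_filter.1 hB).2
    have hBne : B ≠ S := ne_of_mem_filter_levelSet hS hB
    have hcard : (S \ B).card = S.card - B.card := Finset.card_sdiff_of_subset hBS
    have hBle : B.card ≤ S.card := Finset.card_le_card hBS
    have hpos : 0 < (S \ B).card := by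
      rw [Finset.card_pos]
      by_contra hemp
      rw [Finset.not_nonempty_iff_eq_empty, Finset.sdiff_eq_empty_iff_subset] at hemp
      exact hBne (Finset.Subset.antisymm hBS hemp)
    rcases Nat.lt_or_ge (S \ B).card 3 with hlt | hge
    · have he2 : (S \ B).card = 2 := by omega
      exact w4n_eq_zero_of_sdiff_card_two_of_card_ne_two he2 (by omega)
    · exact w4n_eq_zero_of_three_le_sdiff_card hge
  -- the paying sets number at most one
  have huniq : (Φ.filter (fun B => (S \ B).card = 1)).card ≤ 1 := by
    rw [Finset.card_le_one]
    intro B hB B' hB'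
    rw [Finset.mem_filter] at hB hB'
    obtain ⟨y, hy⟩ := Finset.card_eq_one.1 hB.2
    obtain ⟨y', hy'⟩ := Finset.card_eq_one.1 hB'.2
    have hBS : B ⊆ S := (Finset.mem_filter.1 hB.1).2
    have hB'S : B' ⊆ S := (Finset.mem_filter.1 hB'.1).2
    have hB2 : M.eRk (B : Set α) = 2 := (Profile.mem_Rq.1 (Finset.mem_filter.1 hB.1).1).2
    have hB'2 : M.eRk (B' : Set α) = 2 := (Profile.mem_Rq.1 (Finset.mem_filter.1 hB'.1).1).2
    have hyS : y ∈ S := by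
      have : y ∈ S \ B := by rw [hy]; exact Finset.mem_singleton_self y
      exact (Finset.mem_sdiff.1 this).1
    have hy'S : y' ∈ S := by
      have : y' ∈ S \ B' := by rw [hy']; exact Finset.mem_singleton_self y'
      exact (Finset.mem_sdiff.1 this).1
    have hBe : B = S.erase y := by
      ext x
      rw [Finset.mem_erase]
      constructor
      · intro hx
        refine ⟨?_, hBS hx⟩
        rintro rfl
        have : x ∈ S \ B := by rw [hy]; exact Finset.mem_singleton_self x
        exact (Finset.mem_sdiff.1 this).2 hx
      · rintro ⟨hxy, hxS⟩
        by_contra hxB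
        have : x ∈ S \ B := Finset.mem_sdiff.2 ⟨hxS, hxB⟩
        rw [hy, Finset.mem_singleton] at this
        exact hxy this
    have hB'e : B' = S.erase y' := by
      ext x
      rw [Finset.mem_erase]
      constructor
      · intro hx
        refine ⟨?_, hB'S hx⟩
        rintro rfl
        have : x ∈ S \ B' := by rw [hy']; exact Finset.mem_singleton_self x
        exact (Finset.mem_sdiff.1 this).2 hx
      · rintro ⟨hxy, hxS⟩
        by_contra hxB
        have : x ∈ S \ B' := Finset.mem_sdiff.2 ⟨hxS, hxB⟩
        rw [hy', Finset.mem_singleton] at this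
        exact hxy this
    rw [hBe] at hB2
    rw [hB'e] at hB'2
    have := eq_of_erase_eRk_two hsimple hSg hS3 hS5 hyS hy'S hB2 hB'2
    rw [hBe, hB'e, this]
  -- the paying set is paid at most 2
  have hbound : ∀ B ∈ Φ.filter (fun B => (S \ B).card = 1), w4n M B S ≤ 2 := by
    intro B hB
    rw [Finset.mem_filter] at hB
    obtain ⟨y, hy⟩ := Finset.card_eq_one.1 hB.2
    have hBS : B ⊆ S := (Finset.mem_filter.1 hB.1).2
    have hB3 : 3 ≤ B.card := by
      have := Finset.card_sdiff_of_subset hBS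
      rw [hB.2] at this
      omega
    exact w4n_le_two_of_sdiff_singleton hR hsimple hS (Finset.mem_filter.1 hB.1).1 hBS hB3 hy
  calc ∑ B ∈ Φ, w4n M B S
      = ∑ B ∈ Φ.filter (fun B => (S \ B).card = 1), w4n M B S +
          ∑ B ∈ Φ.filter (fun B => ¬ (S \ B).card = 1), w4n M B S :=
        (Finset.sum_filter_add_sum_filter_not _ _ _).symm
    _ ≤ ∑ _B ∈ Φ.filter (fun B => (S \ B).card = 1), (2 : ℚ) + 0 := by
        apply add_le_add (Finset.sum_le_sum hbound)
        apply le_of_eq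
        apply Finset.sum_eq_zero
        intro B hB
        rw [Finset.mem_filter] at hB
        exact hzero B hB.1 hB.2
    _ = ((Φ.filter (fun B => (S \ B).card = 1)).card : ℚ) * 2 := by
        rw [Finset.sum_const, nsmul_eq_mul, add_zero]
    _ ≤ 1 * 2 := by
        apply mul_le_mul_of_nonneg_right _ (by norm_num)
        exact_mod_cast huniq
    _ ≤ 3 := by norm_num

end CapD

end PercRepro
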